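import Summits.ResolutionOfSingularities.ResolutionOfSingularities.Theorems.LossEntryW11
import HarnessLib

/-!
# LossEntryW31 — decomp-res lens-3 g29 «LossEntryWalk», landing part 31 (slice 23): the wall-step skeleton with
CARRIED DATA

Residual `stmt-ResolutionOfSingularities-27367`.  Tree-only import (`LossEntryW11`); independent of parts 12–30.

`lawLossEntryAt_of_wallSteps_data` is the ordinate skeleton `LossEntryW12.lawLossEntryAt_of_wallSteps'` with the
state predicate and the potential allowed to depend on CARRIED DATA `d : D` (for the assembly: the frame letters and
the in-wall root of the one-wall chain state, NODE-g29 §3ter): (h1) the loss at a heavy run state produces data at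
`t+1` with `B ≤ β_t`; (h2) a loss move from a state with data produces data at the next state without increasing `B`;
(h3) the proximity repeat from a state with data lands in the run state of `lossMove_next` with `β < B`.  Conclusion
`LawLossEntryAt W N s`.  This removes the need to define the frame/root INTRINSICALLY as a function of the stage: the
assembly produces them existentially, step by step, from START (`LossEntryW30`), the propagation laws
(`LossEntryW25/27/28`) and END′ (`LossEntryW26/29`).  Complete proof, standard axioms.

(Sources: Hauser2010 §F; HauserPerlega2019 §2; CossartJannsenSaito2020 Ch. 8; Moh1987; Perlega2022.)
-/

open MvPolynomial Finset
open Literature.AlgebraicGeometry.Resolution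
open Literature.AlgebraicGeometry.Resolution.Hauser2010
open Literature.AlgebraicGeometry.Resolution.PointBlowup
open Summit.ResolutionOfSingularities.ResolutionOfSingularities.Theorems.TightDefectClasses
open Summit.ResolutionOfSingularities.ResolutionOfSingularities.Theorems.TightDefectStrongWalks
open Summit.ResolutionOfSingularities.ResolutionOfSingularities.Theorems.ItineraryCutClasses
open Summit.ResolutionOfSingularities.ResolutionOfSingularities.Theorems.BoundaryLedger
open Summit.ResolutionOfSingularities.ResolutionOfSingularities.Theorems.ProximityCut
open Summit.ResolutionOfSingularities.ResolutionOfSingularities.Theorems.LossExitCone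
open Summit.ResolutionOfSingularities.ResolutionOfSingularities.Theorems.LossPolygon

namespace Summit.ResolutionOfSingularities.ResolutionOfSingularities.Theorems.LossEpisode

section ChainSkeletonData

variable {K : Type} [Field K] [DecidableEq K] {q : ℕ} {s₀ : State (Fin 3) K} {W : ForcedWalk q s₀} {N s : ℕ}

/-- **THE WALL-STEP SKELETON WITH CARRIED DATA (PROVED).**  See the module docstring. [new] -/
theorem lawLossEntryAt_of_wallSteps_data (hroot : IsRoot q s₀) (hT : TailHyp W N s) {D : Type}
    (P : ℕ → D → Prop) (B : ℕ → D → ℚ)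
    (h1 : ∀ t : ℕ, N ≤ t → ∀ (i j l : Fin 3) (k m : ℕ), IsRunState W s t i j l k m → q ≤ m + s → IsLossMove W t →
      ∃ d : D, P (t + 1) d ∧ B (t + 1) d ≤ runBeta W s t i j l)
    (h2 : ∀ v : ℕ, N < v → ∀ d : D, P v d → IsLossMove W v → ∃ d' : D, P (v + 1) d' ∧ B (v + 1) d' ≤ B v d)
    (h3 : ∀ v : ℕ, N ≤ v → IsLossMove W v → StaysOnNewest W v → ∀ d : D, P (v + 1) d →
      ∀ (l' : Fin 3) (d₀ T : ℕ), IsRunState W s (v + 2) (W.j (v + 1)) (W.j v) l' d₀ T →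
        runBeta W s (v + 2) (W.j (v + 1)) (W.j v) l' < B (v + 1) d) :
    LawLossEntryAt W N s := by
  intro t hNt i j l k m hS hm hloss
  obtain ⟨d₁, hP1, hB1⟩ := h1 t hNt i j l k m hS hm hloss
  obtain ⟨w, htw, hlw, hsw, hrun⟩ := exists_stays_after_loss hroot hT hNt hloss
  have key : ∀ n : ℕ, t + n ≤ w → ∃ d : D, P (t + n + 1) d ∧ B (t + n + 1) d ≤ B (t + 1) d₁ := by
    intro n
    induction n with
    | zero => intro _; exact ⟨d₁, hP1, le_rfl⟩
    | succ n ih =>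
      intro hn
      obtain ⟨d, hP, hB⟩ := ih (by omega)
      have hlx : IsLossMove W (t + n + 1) := by
        by_cases hx : t + n + 1 = w
        · rw [hx]; exact hlw
        · exact (hrun (t + n + 1) (by omega) (by omega)).1
      obtain ⟨d', hP', hB'⟩ := h2 (t + n + 1) (by omega) d hP hlx
      rw [show t + (n + 1) + 1 = t + n + 1 + 1 by omega]
      exact ⟨d', hP', hB'.trans hB⟩
  obtain ⟨d, hPw, hBw⟩ := key (w - t) (by omega)
  rw [show t + (w - t) + 1 = w + 1 by omega] at hPw hBw
  obtain ⟨T, -, -, -, hqT, hnext⟩ := lossMove_next hroot hT (by omega : N ≤ w) hlw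
  rcases hnext with ⟨hnst, -, -⟩ | ⟨-, l', d₀, -, -, hTd, h1d, hS'⟩
  · exact absurd hsw hnst
  have hβ := h3 w (by omega) hlw hsw d hPw l' d₀ T hS'
  exact ⟨w + 2, by omega, _, _, _, _, _, hS', hqT.le, lt_of_lt_of_le hβ (hBw.trans hB1)⟩

/-- **Variant with the chain position exposed to (h2) (PROVED):** the step hypothesis may also use that the PREVIOUS
move was a loss that did not stay on its newest wall (so the current state is a one-wall state whose move leaves or is an
α-step) — the form in which the propagation laws `LossEntryW25/27/28` are stated. [new] -/
theorem lawLossEntryAt_of_wallSteps_data' (hroot : IsRoot q s₀) (hT : TailHyp W N s) {D : Type}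
    (P : ℕ → D → Prop) (B : ℕ → D → ℚ)
    (h1 : ∀ t : ℕ, N ≤ t → ∀ (i j l : Fin 3) (k m : ℕ), IsRunState W s t i j l k m → q ≤ m + s → IsLossMove W t →
      ∃ d : D, P (t + 1) d ∧ B (t + 1) d ≤ runBeta W s t i j l)
    (h2 : ∀ v : ℕ, N < v → ∀ d : D, P v d → IsLossMove W (v - 1) → ¬ StaysOnNewest W (v - 1) → IsLossMove W v →
      ∃ d' : D, P (v + 1) d' ∧ B (v + 1) d' ≤ B v d)
    (h3 : ∀ v : ℕ, N ≤ v → IsLossMove W v → StaysOnNewest W v → ∀ d : D, P (v + 1) d →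
      ∀ (l' : Fin 3) (d₀ T : ℕ), IsRunState W s (v + 2) (W.j (v + 1)) (W.j v) l' d₀ T →
        runBeta W s (v + 2) (W.j (v + 1)) (W.j v) l' < B (v + 1) d) :
    LawLossEntryAt W N s := by
  intro t hNt i j l k m hS hm hloss
  obtain ⟨d₁, hP1, hB1⟩ := h1 t hNt i j l k m hS hm hloss
  obtain ⟨w, htw, hlw, hsw, hrun⟩ := exists_stays_after_loss hroot hT hNt hloss
  have key : ∀ n : ℕ, t + n ≤ w → ∃ d : D, P (t + n + 1) d ∧ B (t + n + 1) d ≤ B (t + 1) d₁ := by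
    intro n
    induction n with
    | zero => intro _; exact ⟨d₁, hP1, le_rfl⟩
    | succ n ih =>
      intro hn
      obtain ⟨d, hP, hB⟩ := ih (by omega)
      have hlx : IsLossMove W (t + n + 1) := by
        by_cases hx : t + n + 1 = w
        · rw [hx]; exact hlw
        · exact (hrun (t + n + 1) (by omega) (by omega)).1
      have hprev := hrun (t + n) (by omega) (by omega)
      obtain ⟨d', hP', hB'⟩ := h2 (t + n + 1) (by omega) d hP (by rw [Nat.add_sub_cancel]; exact hprev.1)
        (by rw [Nat.add_sub_cancel]; exact hprev.2) hlx
      rw [show t + (n + 1) + 1 = t + n + 1 + 1 by omega]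
      exact ⟨d', hP', hB'.trans hB⟩
  obtain ⟨d, hPw, hBw⟩ := key (w - t) (by omega)
  rw [show t + (w - t) + 1 = w + 1 by omega] at hPw hBw
  obtain ⟨T, -, -, -, hqT, hnext⟩ := lossMove_next hroot hT (by omega : N ≤ w) hlw
  rcases hnext with ⟨hnst, -, -⟩ | ⟨-, l', d₀, -, -, hTd, h1d, hS'⟩
  · exact absurd hsw hnst
  have hβ := h3 w (by omega) hlw hsw d hPw l' d₀ T hS'
  exact ⟨w + 2, by omega, _, _, _, _, _, hS', hqT.le, lt_of_lt_of_le hβ (hBw.trans hB1)⟩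

end ChainSkeletonData

end Summit.ResolutionOfSingularities.ResolutionOfSingularities.Theorems.LossEpisode
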